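import Literature.NumberTheory.GaloisRepresentations.ArtinRestriction
import Literature.NumberTheory.GaloisRepresentations.AbsGaloisGroupCompact
import Mathlib.GroupTheory.Sylow
import HarnessLib

/-!
# The fixed field of a `p`-Sylow subgroup: a finite extension of degree prime to `p` over which
# a given open normal subgroup of `Γ_K` becomes "`p`-power-distant"

Route `KolyvaginRoadThree`, crux `ZhangSharpFrameAtThreeHL` (stmt-BirchSwinnertonDyer-19574), PT road,
instance (I) (`PT-ROAD-DESIGN-g19.md` §2 (I)): the prime-to-`p` descent
(`middleExact_canonical_of_descentData`) is applied along the fixed field of a `p`-Sylow subgroup of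
the (finite) image of `Γ_K` acting on `E[p] × μₚ`.  This file supplies the Galois-theoretic input in
general form: for a field `K` of characteristic `0`, a prime `p` and an OPEN NORMAL subgroup `U ≤ Γ_K`,
there is a finite subextension `K'' ⊆ K̄` of `K` with

* `p ∤ [K'' : K]` (`[K'' : K] = [Γ_K/U : P]` for a `p`-Sylow `P` of the finite group `Γ_K/U`), and
* every element of the image of `Γ_{K''} → Γ_K` (the tree's `absGaloisRestrict`, well defined up to
  conjugacy) has a `p`-power power in `U`

(`exists_fixedField_coprime_pow_mem`): `K'' = K̄^H` with `H` the preimage of `P`; the image of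
`Γ_{K''}` is a conjugate of `H` (`exists_mem_range_absGaloisRestrict_fixedField_iff`), `P` is a `p`-group,
and `U` is normal.  THEOREMS only; no named fact; no case of BSD.

References: [NeukirchANT1999] Ch. IV §1 (Krull); [SerreGaloisCohomology1997] I §3.3 (Sylow
subgroups of profinite groups); Sylow's theorems (Mathlib `Sylow`).
-/

noncomputable section

open Function Field

set_option linter.dupNamespace false
set_option autoImplicit false

namespace Summit.BirchSwinnertonDyer.BirchSwinnertonDyer.Theorems.KolyvaginRoadThreePT

open Literature.NumberTheory.GaloisRepresentations

section Sylow

variable {K : Type} [Field K] [CharZero K] {p : ℕ} [hp : Fact p.Prime]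

omit [CharZero K] in
/-- An open subgroup of the compact group `Γ_K` has finite index. [cite: SerreGaloisCohomology1997, I §1.1] -/
theorem finiteIndex_of_isOpen (U : Subgroup (absoluteGaloisGroup K)) (hU : IsOpen (U : Set (absoluteGaloisGroup K))) :
    U.FiniteIndex := by
  haveI : CompactSpace (absoluteGaloisGroup K) := absoluteGaloisGroup_compactSpace K
  haveI := Subgroup.quotient_finite_of_isOpen U hU
  exact Subgroup.finiteIndex_of_finite_quotient

/-- **The `p`-Sylow fixed field.**  For an open normal subgroup `U ≤ Γ_K` there is a finite subextension
`K'' = K̄^H ⊆ K̄` of `K` of degree prime to `p` such that every `γ` in the image of `Γ_{K''} → Γ_K`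
satisfies `γ ^ (p ^ k) ∈ U` for some `k` (`H` = preimage of a `p`-Sylow subgroup of `Γ_K/U`; the image
of `Γ_{K''}` is a conjugate of `H`). [cite: NeukirchANT1999, Ch. IV §1 Thm. (1.2)] -/
theorem exists_fixedField_coprime_pow_mem (U : Subgroup (absoluteGaloisGroup K)) [U.Normal]
    (hU : IsOpen (U : Set (absoluteGaloisGroup K))) :
    ∃ (H : Subgroup (absoluteGaloisGroup K)) (_ : IsOpen (H : Set (absoluteGaloisGroup K))),
      p.Coprime (Module.finrank K (IntermediateField.fixedField H : IntermediateField K (AlgebraicClosure K))) ∧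
      ∀ σ : absoluteGaloisGroup (IntermediateField.fixedField H : IntermediateField K (AlgebraicClosure K)),
        ∃ k : ℕ, (absGaloisRestrict K (IntermediateField.fixedField H :
          IntermediateField K (AlgebraicClosure K)) σ) ^ (p ^ k) ∈ U := by
  haveI := finiteIndex_of_isOpen U hU
  haveI : Finite (absoluteGaloisGroup K ⧸ U) := Subgroup.finite_quotient_of_finiteIndex
  -- a `p`-Sylow subgroup of the finite quotient and its preimage
  let P : Sylow p (absoluteGaloisGroup K ⧸ U) := default
  let H : Subgroup (absoluteGaloisGroup K) := (P : Subgroup (absoluteGaloisGroup K ⧸ U)).comap (QuotientGroup.mk' U)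
  have hUH : U ≤ H := fun u hu => by
    change QuotientGroup.mk' U u ∈ (P : Subgroup (absoluteGaloisGroup K ⧸ U))
    rw [QuotientGroup.mk'_apply, (QuotientGroup.eq_one_iff u).mpr hu]
    exact one_mem _
  have hH : IsOpen (H : Set (absoluteGaloisGroup K)) := Subgroup.isOpen_mono hUH hU
  refine ⟨H, hH, ?_, fun σ => ?_⟩
  · -- degree `= [Γ_K : H] = [Γ_K/U : P]`, prime to `p`
    rw [finrank_fixedField_of_isOpen H hH,
      Subgroup.index_comap_of_surjective _ (QuotientGroup.mk'_surjective U)]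
    haveI : (P : Subgroup (absoluteGaloisGroup K ⧸ U)).FiniteIndex := Subgroup.finiteIndex_of_finite
    exact (Nat.Prime.coprime_iff_not_dvd hp.out).mpr P.not_dvd_index
  · -- the image of `Γ_{K''}` is a conjugate of `H`; `P` is a `p`-group; `U` is normal
    obtain ⟨g, hg⟩ := exists_mem_range_absGaloisRestrict_fixedField_iff H hH
    set γ := absGaloisRestrict K (IntermediateField.fixedField H : IntermediateField K (AlgebraicClosure K)) σ
    have hγ : g⁻¹ * γ * g ∈ H := (hg γ).mp ⟨σ, rfl⟩
    obtain ⟨k, hk⟩ := P.isPGroup' ⟨QuotientGroup.mk' U (g⁻¹ * γ * g), hγ⟩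
    refine ⟨k, ?_⟩
    have hk' : (QuotientGroup.mk' U (g⁻¹ * γ * g)) ^ (p ^ k) = 1 := by
      have := congrArg Subtype.val hk
      simpa using this
    rw [← map_pow, QuotientGroup.mk'_apply, QuotientGroup.eq_one_iff] at hk'
    have hconj : (g⁻¹ * γ * g) ^ (p ^ k) = g⁻¹ * γ ^ (p ^ k) * g := by
      rw [show g⁻¹ * γ * g = g⁻¹ * γ * g⁻¹⁻¹ by rw [inv_inv], conj_pow, inv_inv]
    rw [hconj] at hk'
    have := Subgroup.Normal.conj_mem inferInstance _ hk' g
    rwa [show g * (g⁻¹ * γ ^ p ^ k * g) * g⁻¹ = γ ^ p ^ k by group] at this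

end Sylow

end Summit.BirchSwinnertonDyer.BirchSwinnertonDyer.Theorems.KolyvaginRoadThreePT

end
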